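import Summits.ResolutionOfSingularities.ResolutionOfSingularities.Theorems.FrobeniusClosingCascade
import Summits.ResolutionOfSingularities.ResolutionOfSingularities.Theorems.WildConesClassicalRegimes
import Summits.ResolutionOfSingularities.ResolutionOfSingularities.Theorems.WildConesAssembly

/-!
# Route `FrobeniusClosing`, crux `BoundedMilnor` (stmt-ResolutionOfSingularities-16346) — PROVED

`BoundedMilnor` ("along every infinite isolated multiplicity-`p` run of the point-blow-up dynamics of
a height-one atom over a perfect field, the Milnor-type colength `μ` is bounded") holds VACUOUSLY:
there is no such run. The chain of landed results: the `p = 2` Milnor descent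
`Theorems.WildCones.ClassicalRegimes_proof` (crux `ClassicalRegimes`, stmt-16884, line
`milnor-descent`) feeds the `WildCones` engine
`Theorems.WildCones.frobeniusClosing_isolatedForcedTermination_of_classicalRegimes` (cone exit +
narrow runs die for `p` odd, `n ≥ 3`), which yields the target `IsolatedForcedTermination`
(stmt-16343); and `Theorems.FrobeniusClosing.boundedMilnor_of_isolatedForcedTermination`
(`Theorems/FrobeniusClosingCascade.lean`) turns the target into the crux. Chain W4.1
(`L/w41/CHAIN.md` v1, cascade F7). [folklore]
-/

noncomputable section

-- single-problem summit: the doubled namespace component `ResolutionOfSingularities` is forced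
set_option linter.dupNamespace false

open Summit.ResolutionOfSingularities.ResolutionOfSingularities.Theses.FrobeniusClosing
  (IsolatedForcedTermination BoundedMilnor)

namespace Summit.ResolutionOfSingularities.ResolutionOfSingularities.Theorems.FrobeniusClosing

/-- Route `FrobeniusClosing`'s target `IsolatedForcedTermination` (stmt-16343), assembled from the
landed `WildCones` engine and the landed `ClassicalRegimes_proof`. [folklore] -/
theorem isolatedForcedTermination_of_landed : IsolatedForcedTermination :=
  WildCones.frobeniusClosing_isolatedForcedTermination_of_classicalRegimes WildCones.ClassicalRegimes_proof

/-- **The crux `BoundedMilnor` of route `FrobeniusClosing` (stmt-ResolutionOfSingularities-16346),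
PROVED** — vacuously, from the target. [folklore] -/
theorem BoundedMilnor_proof : BoundedMilnor :=
  boundedMilnor_of_isolatedForcedTermination isolatedForcedTermination_of_landed

end Summit.ResolutionOfSingularities.ResolutionOfSingularities.Theorems.FrobeniusClosing

end
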